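import Summits.Parity.GeneralizedHardyLittlewood.Theses.RealCharacterThetaLadder

/-!
# Route `RealCharacterThetaLadder` — the assembly item

The assembly item of route `RealCharacterThetaLadder` (Parity / GeneralizedHardyLittlewood, D-0059
rung F-P2, wide leaf): the five range × parity blocks
`PlattRange` (`q ≤ 4·10⁵`, both parities), `OddToHundredMillion` / `EvenToHundredMillion`
(`4·10⁵ < q ≤ 10⁸`), `OddToBillion` / `EvenToBillion` (`10⁸ < q ≤ 10⁹`) together give
`NoRealZeroUpTo 1000000000`. Pure logic: range trichotomy and `DirichletCharacter.even_or_odd`.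
Nothing analytic or numerical is proved here; the blocks stay open items (their currency is
certified numerics, HOME/DATA.md of cell `parity-realchar`).
-/

namespace Summit.Parity.GeneralizedHardyLittlewood.Theorems

open Summit.Parity.GeneralizedHardyLittlewood.Theses

/-- **Assembly of route `RealCharacterThetaLadder`** (item `Assembly`): if no primitive quadratic
`L(s, χ)` has a real zero in `(0, 1)` for `3 ≤ q ≤ 4·10⁵` (both parities), for even and for odd `χ`
with `4·10⁵ < q ≤ 10⁸`, and for even and for odd `χ` with `10⁸ < q ≤ 10⁹`, then none has one for
`3 ≤ q ≤ 10⁹` (`NoRealZeroUpTo 1000000000`). Proof: split `q ≤ 4·10⁵ ∨ 4·10⁵ < q ≤ 10⁸ ∨ 10⁸ < q`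
and `χ` even or odd. -/
theorem realCharacterThetaLadder_assembly_proof : RealCharacterThetaLadder.Assembly := by
  unfold RealCharacterThetaLadder.Assembly
  intro h0 h1o h1e h2o h2e q _ hq3 hqQ χ hquad hprim σ hσ0 hσ1
  by_cases hq0 : q ≤ 400000
  · exact h0 q hq3 hq0 χ hquad hprim σ hσ0 hσ1
  · by_cases hq1 : q ≤ 100000000
    · rcases χ.even_or_odd with hev | hod
      · exact h1e q (by omega) hq1 χ hquad hprim hev σ hσ0 hσ1
      · exact h1o q (by omega) hq1 χ hquad hprim hod σ hσ0 hσ1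
    · rcases χ.even_or_odd with hev | hod
      · exact h2e q (by omega) hqQ χ hquad hprim hev σ hσ0 hσ1
      · exact h2o q (by omega) hqQ χ hquad hprim hod σ hσ0 hσ1

end Summit.Parity.GeneralizedHardyLittlewood.Theorems
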